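import Literature.AnabelianGeometry.SemiGraphs.TemperedAnabelianThm64SubCoveringDatumWitness
import HarnessLib

/-!
# [SemiAnbd] Thm. 6.4 sub-DAG: ALL inputs of Theorem 6.4 — F-2831, F-2832, F-2836 — and the typed node hold
# JOINTLY at a NON-IDENTITY covering datum (the constant-field covering over the degenerate inhabitant)

S. Mochizuki, *Semi-graphs of anabelioids*, Publ. RIMS **42** (2006) [SemiAnbd], §6, Theorem 6.4 and its
proof, kurims p. 70 l. 34 – p. 71 l. 21 ("by [Mzk8], Theorem 1.2 [i.e., in essence, [Mzk2], Theorem A], we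
obtain that `φ̂` arises, up to inner automorphism, from a dominant morphism of schemes", p. 71 l. 13–15).
[cite: MochizukiSemiAnbd2006, Thm 6.4 pp.70-71]

PROOF-ONLY supplement (theorems only; no definition, no instance, no new named fact) to
`TemperedAnabelianThm64SubCoveringDatum.lean` (abc-iut-f-168 gen 7, p489170: F-2831 / F-2832 on the
finite-étale-covering class) and `TemperedAnabelianThm64SubCoveringDatumWitness.lean` (abc-iut-w6-d085 gen 4,
p490549: the class is inhabited BEYOND the identity datum at EVERY `Y` by the constant-field coverings
`Y_{K'} → Y_L`, `H_{K'} = aug⁻¹(G_{K'})`, all side data hypothesis-free), cell abc-iut, D-0079 L-F sub-cell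
[SemiAnbd]+[CombGC], pack D; FROZEN FACT-LIST rows F-2831 `TemperedCurve.GeometricIsDFG`, F-2832
`TemperedCurve.GeometricIsGaloisCompatible`, F-2836 `TemperedCurve.ProfiniteAnabelianTheorem`.

What this file adds (consumed BY NAME from the two files above, nothing restated): the remaining input of
Thm. 6.4, T64-L04 = [Mzk8] Thm. 1.2 read on the interface (`ProfiniteAnabelianTheorem`, row F-2836 — so far
instanced only at IDENTITY data, abc-iut-f-170 `profiniteAnabelianTheorem_id_degenerate`), ALSO holds at a
NON-identity covering datum, and with it the typed node:

* `profiniteAnabelianTheorem_constantField_degenerate` — at the tree's inhabitant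
  `Y₀ := TemperedCurve.degenerate p` (abc-iut-c312-4: `Π^temp = Π = G_{ℚ_p}`, `K = ℚ_p`, augmentation `= id`, no
  closed points) and ANY finite `K'/ℚ_p` inside `ℚ̄_p`, the constant-field covering datum
  `⟨Unit, fun _ => (H_{K'} ↪ G_{ℚ_p})⟩` on `(X_{H_{K'}}, Y₀)` satisfies F-2836: an OPEN `Φ : Π_X = G_{K'} → Π_{Y₀} = G_{ℚ_p}`
  lying over some `h ↦ g⁻¹ h g` IS that map, i.e. is `Π_{Y₀}`-conjugate (by `c = g⁻¹`) to `π₁(X → Y₀)` = the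
  inclusion; injectivity on the one-element set of morphisms is trivial;
* `allInputs_constantField_degenerate` — there F-2831 (p489170's covering theorem, its one leaf discharged by
  compactness of `G_{ℚ_p}`), F-2832 (p490549, hypothesis-free), F-2836 (above) and hence the typed node
  `TemperedAnabelianTheorem` ([SemiAnbd] Thm. 6.4 AS TYPED; abc-iut-w4-d076's
  `temperedAnabelianTheorem_of_inputs_of_toHat_surjective` with Lemma 6.3 (ii) `piTempDFGIffDOF_degenerate`)
  hold TOGETHER;
* `exists_nonidentity_coveringDatum_allInputs` — packaged: some `Y`, a PROPER (`H ≠ ⊤`, `K < K'`) open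
  subgroup of finite index with all side data, at whose covering datum F-2831 ∧ F-2832 ∧ F-2836 ∧ the typed
  node hold with a nonempty set of dominant morphisms (`K' ⊋ ℚ_p` from p490549's `exists_finiteDimensional_lt`)
  — the non-identity analogue of abc-iut-f-170's `exists_identityDatum_allSteps`.

HONEST LIMITS.  Consistency evidence about OUR interface (`G_{ℚ_p}` is not the tempered fundamental group of
a hyperbolic curve); nothing of [SemiAnbd] / [Mzk8] is asserted or denied; typed ≠ proved; instance ≠ the
printed universal statement; no side taken on [IUTchIII] Cor. 3.12.
-/

noncomputable section

namespace Literature.AnabelianGeometry.SemiGraphs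

namespace TemperedCurve

open _root_.Topology

section Degenerate

variable (p : ℕ) [Fact p.Prime] (K' : IntermediateField ℚ_[p] (AlgebraicClosure ℚ_[p]))
  [FiniteDimensional ℚ_[p] K']

/-- **F-2836 ([Mzk8] Thm. 1.2 read on the interface) at the constant-field covering `X_{H_{K'}} → Y₀`.**  At these
data `Π^temp = Π` on both sides with identity augmentations into `G_{ℚ_p}`, so an open
`Φ : Π_X = G_{K'} → Π_{Y₀} = G_{ℚ_p}` lying over some `h ↦ g⁻¹ h g` IS `h ↦ g⁻¹ h g`, i.e. `Π_{Y₀}`-conjugate (by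
`c = g⁻¹`) to `π₁(X → Y₀)` = the inclusion (surjectivity half); injectivity on the one-element set of
morphisms is trivial.  Consistency evidence for the binder `h04` at a non-identity datum; [Mzk8] Thm. 1.2 is
not asserted. [cite: MochizukiSemiAnbd2006, Thm 6.4 proof p.71] -/
theorem profiniteAnabelianTheorem_constantField_degenerate :
    letI := (TemperedCurve.degenerate p).finiteIndex_comap_aug_fixingSubgroup K' bot_le
    ProfiniteAnabelianTheorem (⟨Unit, fun _ => ContinuousMonoidHom.mk
        (K'.fixingSubgroup.comap (TemperedCurve.degenerate p).aug.toMonoidHom :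
          Subgroup (TemperedCurve.degenerate p).PiTemp).subtype continuous_subtype_val⟩ :
      TemperedCurveHom p ((TemperedCurve.degenerate p).ofOpenSubgroup
        (K'.fixingSubgroup.comap (TemperedCurve.degenerate p).aug.toMonoidHom)
        ((TemperedCurve.degenerate p).isOpen_comap_aug_fixingSubgroup K') K'
        ((TemperedCurve.degenerate p).range_aug_comp_subtype_comap_aug_fixingSubgroup K' bot_le)
        ((TemperedCurve.degenerate p).isOpen_image_aug_decompOfOpenAt_comap_aug_fixingSubgroup K'))
        (TemperedCurve.degenerate p)) := by
  letI := (TemperedCurve.degenerate p).finiteIndex_comap_aug_fixingSubgroup K' bot_le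
  refine ⟨fun Φ hΦ => ?_, fun f f' _ => Subsingleton.elim _ _⟩
  obtain ⟨-, g, -, hg⟩ := hΦ
  refine ⟨(), g⁻¹, fun x => ?_⟩
  -- `augHat_{Y₀} = id`, `augHat_X = (Π_X ↪ G_{ℚ_p})`, `toHat_{Y₀} = id`, `π₁ = (H ↪ G_{ℚ_p})`: all definitional
  have := hg (((TemperedCurve.degenerate p).ofOpenSubgroup
        (K'.fixingSubgroup.comap (TemperedCurve.degenerate p).aug.toMonoidHom)
        ((TemperedCurve.degenerate p).isOpen_comap_aug_fixingSubgroup K') K'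
        ((TemperedCurve.degenerate p).range_aug_comp_subtype_comap_aug_fixingSubgroup K' bot_le)
        ((TemperedCurve.degenerate p).isOpen_image_aug_decompOfOpenAt_comap_aug_fixingSubgroup K')).toHat x)
  rw [inv_inv]
  exact this

/-- **ALL inputs of [SemiAnbd] Thm. 6.4 and the typed node, jointly, at the NON-IDENTITY covering datum
`X_{H_{K'}} → Y₀`**: F-2831 `GeometricIsDFG` (p489170's `geometricIsDFG_covering_of_fg_quotients`; leaf discharged
by compactness of `G_{ℚ_p}`, `fg_quotient_of_compactSpace`), F-2832 `GeometricIsGaloisCompatible` (p490549's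
`geometricIsGaloisCompatible_constantField_inclusion`, hypothesis-free), F-2836 `ProfiniteAnabelianTheorem`
(above), hence `TemperedAnabelianTheorem` (abc-iut-w4-d076's `temperedAnabelianTheorem_of_inputs_of_toHat_surjective`
with `toHat_surjective_degenerate` and Lemma 6.3 (ii) `piTempDFGIffDOF_degenerate`).
[cite: MochizukiSemiAnbd2006, Thm 6.4 pp.70-71] -/
theorem allInputs_constantField_degenerate :
    letI := (TemperedCurve.degenerate p).finiteIndex_comap_aug_fixingSubgroup K' bot_le
    GeometricIsDFG (⟨Unit, fun _ => ContinuousMonoidHom.mk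
        (K'.fixingSubgroup.comap (TemperedCurve.degenerate p).aug.toMonoidHom :
          Subgroup (TemperedCurve.degenerate p).PiTemp).subtype continuous_subtype_val⟩ :
      TemperedCurveHom p ((TemperedCurve.degenerate p).ofOpenSubgroup
        (K'.fixingSubgroup.comap (TemperedCurve.degenerate p).aug.toMonoidHom)
        ((TemperedCurve.degenerate p).isOpen_comap_aug_fixingSubgroup K') K'
        ((TemperedCurve.degenerate p).range_aug_comp_subtype_comap_aug_fixingSubgroup K' bot_le)
        ((TemperedCurve.degenerate p).isOpen_image_aug_decompOfOpenAt_comap_aug_fixingSubgroup K'))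
        (TemperedCurve.degenerate p)) ∧
    GeometricIsGaloisCompatible (⟨Unit, fun _ => ContinuousMonoidHom.mk
        (K'.fixingSubgroup.comap (TemperedCurve.degenerate p).aug.toMonoidHom :
          Subgroup (TemperedCurve.degenerate p).PiTemp).subtype continuous_subtype_val⟩ :
      TemperedCurveHom p ((TemperedCurve.degenerate p).ofOpenSubgroup
        (K'.fixingSubgroup.comap (TemperedCurve.degenerate p).aug.toMonoidHom)
        ((TemperedCurve.degenerate p).isOpen_comap_aug_fixingSubgroup K') K'
        ((TemperedCurve.degenerate p).range_aug_comp_subtype_comap_aug_fixingSubgroup K' bot_le)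
        ((TemperedCurve.degenerate p).isOpen_image_aug_decompOfOpenAt_comap_aug_fixingSubgroup K'))
        (TemperedCurve.degenerate p)) ∧
    ProfiniteAnabelianTheorem (⟨Unit, fun _ => ContinuousMonoidHom.mk
        (K'.fixingSubgroup.comap (TemperedCurve.degenerate p).aug.toMonoidHom :
          Subgroup (TemperedCurve.degenerate p).PiTemp).subtype continuous_subtype_val⟩ :
      TemperedCurveHom p ((TemperedCurve.degenerate p).ofOpenSubgroup
        (K'.fixingSubgroup.comap (TemperedCurve.degenerate p).aug.toMonoidHom)
        ((TemperedCurve.degenerate p).isOpen_comap_aug_fixingSubgroup K') K'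
        ((TemperedCurve.degenerate p).range_aug_comp_subtype_comap_aug_fixingSubgroup K' bot_le)
        ((TemperedCurve.degenerate p).isOpen_image_aug_decompOfOpenAt_comap_aug_fixingSubgroup K'))
        (TemperedCurve.degenerate p)) ∧
    TemperedAnabelianTheorem (⟨Unit, fun _ => ContinuousMonoidHom.mk
        (K'.fixingSubgroup.comap (TemperedCurve.degenerate p).aug.toMonoidHom :
          Subgroup (TemperedCurve.degenerate p).PiTemp).subtype continuous_subtype_val⟩ :
      TemperedCurveHom p ((TemperedCurve.degenerate p).ofOpenSubgroup
        (K'.fixingSubgroup.comap (TemperedCurve.degenerate p).aug.toMonoidHom)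
        ((TemperedCurve.degenerate p).isOpen_comap_aug_fixingSubgroup K') K'
        ((TemperedCurve.degenerate p).range_aug_comp_subtype_comap_aug_fixingSubgroup K' bot_le)
        ((TemperedCurve.degenerate p).isOpen_image_aug_decompOfOpenAt_comap_aug_fixingSubgroup K'))
        (TemperedCurve.degenerate p)) := by
  letI := (TemperedCurve.degenerate p).finiteIndex_comap_aug_fixingSubgroup K' bot_le
  haveI := compactSpace_piTemp_degenerate p
  have h01 := (TemperedCurve.degenerate p).geometricIsDFG_covering_of_fg_quotients _
    ((TemperedCurve.degenerate p).isOpen_comap_aug_fixingSubgroup K') K'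
    ((TemperedCurve.degenerate p).range_aug_comp_subtype_comap_aug_fixingSubgroup K' bot_le)
    ((TemperedCurve.degenerate p).isOpen_image_aug_decompOfOpenAt_comap_aug_fixingSubgroup K')
    (TemperedCurve.degenerate p).fg_quotient_of_compactSpace _
    ((TemperedCurve.degenerate p).inclusionDatum_conj _
      ((TemperedCurve.degenerate p).isOpen_comap_aug_fixingSubgroup K') K'
      ((TemperedCurve.degenerate p).range_aug_comp_subtype_comap_aug_fixingSubgroup K' bot_le)
      ((TemperedCurve.degenerate p).isOpen_image_aug_decompOfOpenAt_comap_aug_fixingSubgroup K')).2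
  have h01b := (TemperedCurve.degenerate p).geometricIsGaloisCompatible_constantField_inclusion K' bot_le
  have h04 := profiniteAnabelianTheorem_constantField_degenerate p K'
  exact ⟨h01, h01b, h04, temperedAnabelianTheorem_of_inputs_of_toHat_surjective _ (toHat_surjective_degenerate p)
    h01 h01b (piTempDFGIffDOF_degenerate p) h04⟩

end Degenerate

/-! ### The existential packaging -/

/-- **The covering class of p489170 carries ALL inputs of Thm. 6.4 at a NON-identity member.**  There are
`Y : TemperedCurve p` and a PROPER open subgroup `H < Π^temp_{Y}` of finite index with the side data of
`TemperedCurve.ofOpenSubgroup` (base field `K' ⊋ K` of the covering) such that the covering datum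
`⟨Unit, fun _ => (H ↪ Π^temp_Y)⟩` on `(X_H, Y)` has a nonempty set of dominant morphisms and satisfies F-2831
`GeometricIsDFG`, F-2832 `GeometricIsGaloisCompatible`, F-2836 `ProfiniteAnabelianTheorem` and the typed node
`TemperedAnabelianTheorem` ([SemiAnbd] Thm. 6.4 as typed).  (Witness: `Y₀ = TemperedCurve.degenerate p` and the
constant-field covering for a proper finite `K' ⊋ ℚ_p`, p490549's `exists_finiteDimensional_lt`; consistency
evidence only.) [cite: MochizukiSemiAnbd2006, Thm 6.4 pp.70-71] -/
theorem exists_nonidentity_coveringDatum_allInputs (p : ℕ) [Fact p.Prime] :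
    ∃ (Y : TemperedCurve p) (H : Subgroup Y.PiTemp) (hHo : IsOpen (H : Set Y.PiTemp)) (hfi : H.FiniteIndex)
      (K' : IntermediateField ℚ_[p] (AlgebraicClosure ℚ_[p])) (_ : FiniteDimensional ℚ_[p] K')
      (hK' : (Y.aug.toMonoidHom.comp H.subtype).range = K'.fixingSubgroup)
      (hDopen : ∀ (y : Y.Pt) (g : Y.PiTemp),
        IsOpen (Y.aug '' ((Y.decompOfOpenAt H y g).map H.subtype : Set Y.PiTemp))),
      H ≠ ⊤ ∧ Y.K < K' ∧
        Nonempty (⟨Unit, fun _ => ContinuousMonoidHom.mk H.subtype continuous_subtype_val⟩ :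
            TemperedCurveHom p (@ofOpenSubgroup p _ Y H hHo hfi K' _ hK' hDopen) Y).DomHom ∧
        GeometricIsDFG (⟨Unit, fun _ => ContinuousMonoidHom.mk H.subtype continuous_subtype_val⟩ :
            TemperedCurveHom p (@ofOpenSubgroup p _ Y H hHo hfi K' _ hK' hDopen) Y) ∧
        GeometricIsGaloisCompatible (⟨Unit, fun _ => ContinuousMonoidHom.mk H.subtype continuous_subtype_val⟩ :
            TemperedCurveHom p (@ofOpenSubgroup p _ Y H hHo hfi K' _ hK' hDopen) Y) ∧
        ProfiniteAnabelianTheorem (⟨Unit, fun _ => ContinuousMonoidHom.mk H.subtype continuous_subtype_val⟩ :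
            TemperedCurveHom p (@ofOpenSubgroup p _ Y H hHo hfi K' _ hK' hDopen) Y) ∧
        TemperedAnabelianTheorem (⟨Unit, fun _ => ContinuousMonoidHom.mk H.subtype continuous_subtype_val⟩ :
            TemperedCurveHom p (@ofOpenSubgroup p _ Y H hHo hfi K' _ hK' hDopen) Y) := by
  obtain ⟨K', hfd, hlt⟩ :=
    exists_finiteDimensional_lt (p := p) (⊥ : IntermediateField ℚ_[p] (AlgebraicClosure ℚ_[p]))
  haveI := hfd
  obtain ⟨h01, h01b, h04, h64⟩ := allInputs_constantField_degenerate p K'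
  exact ⟨TemperedCurve.degenerate p, K'.fixingSubgroup.comap (TemperedCurve.degenerate p).aug.toMonoidHom,
    (TemperedCurve.degenerate p).isOpen_comap_aug_fixingSubgroup K',
    (TemperedCurve.degenerate p).finiteIndex_comap_aug_fixingSubgroup K' bot_le, K', hfd,
    (TemperedCurve.degenerate p).range_aug_comp_subtype_comap_aug_fixingSubgroup K' bot_le,
    (TemperedCurve.degenerate p).isOpen_image_aug_decompOfOpenAt_comap_aug_fixingSubgroup K',
    (TemperedCurve.degenerate p).comap_aug_fixingSubgroup_ne_top K' bot_le hlt.ne, hlt, ⟨()⟩,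
    h01, h01b, h04, h64⟩

end TemperedCurve

end Literature.AnabelianGeometry.SemiGraphs

end
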